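import Literature.NumberTheory.EllipticCurves.Rank1Residual.Predicates
import Literature.NumberTheory.EllipticCurves.NoConductorOne
import Literature.NumberTheory.EllipticCurves.Castella2018.TamagawaQuadraticBaseChangeProofs
import Literature.NumberTheory.DiophantineGeometry.TateAlgorithmOrdDiscriminant
import Literature.NumberTheory.DiophantineGeometry.AbcWave0UniformABCProofs
import HarnessLib

/-!
# Route `GenusKolyvaginAtTwo`, crux K₄⁺ `K4Pos` (stmt-BirchSwinnertonDyer-31469), LINE 33 «twin_bsd_road» v1.4 §6:
# the good-supersingular-at-2 off-cut `Δ > 0` sub-habitat is EMPTY — the three elementary stubs S1, S2, S3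

LEAD seat `bsd-line-gk2-p1` g28; `--supports stmt-BirchSwinnertonDyer-31469` (helper). THEOREMS ONLY; no definition,
no named fact taken as hypothesis, no `sorry`. BSD is not proved by any of this; `K4Pos` is NOT proved here.

* S1 `discr_emod_eight_of_goodSS` — good SUPERSINGULAR reduction at `2` on a globally minimal model forces
  `Δ_min ≡ 5 (mod 8)`: good reduction gives `Δ_min` odd; if `a₁` were odd the reduction mod `2` would carry the
  rational point `(ā₃, ȳ)` with `ȳ = −ȳ − ā₁ā₃ − ā₃` of order `2`, so `#Ẽ(𝔽₂)` would be even and `a₂ = 3 − #Ẽ(𝔽₂)`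
  odd; hence `a₁ = 2α`, then `Δ` odd forces `a₃ = 2γ + 1`, and `Δ = −b₂²b₈ − 8b₄³ − 27b₆² + 9b₂b₄b₆` with
  `4 ∣ b₂`, `2 ∣ b₄`, `b₆² ≡ 1 (8)` gives `Δ ≡ −27 ≡ 5 (mod 8)`.
* S2 `even_padicValInt_discr_of_odd_tamagawaProduct` — on the odd-Tamagawa cell with no odd multiplicative prime,
  every prime `p ≥ 5` has EVEN `v_p(Δ_min)`: a prime `p ≥ 5` dividing `Δ_min` is bad, not multiplicative, hence
  additive; Ogg–Saito in residue characteristic `≥ 5` (`ord_v Δ_min = m_v + 1`, tree theorem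
  `ordMinimalDiscriminant_eq_numComponentsAt_add_one_holds`) and Tate's algorithm (`c_v = 2` for III, III*,
  `c_v ∈ {2,4}` for `Iₙ*`, `n ≥ 1`, tree theorems `localTamagawaNumber_…_holds`) leave the types II, IV, I₀*, IV*, II*
  (`c_v ∣ ∏ c_ℓ` is odd), with `v_p(Δ_min) = 2, 4, 6, 8, 10`.
* S3 `no_pos_int_five_mod_eight_of_even_val` — pure arithmetic: a positive integer `≡ 5 (mod 8)` has a prime
  `p ≥ 5` of odd valuation (else `Δ = 3^a · m²`, `m` odd, `≡ 1, 3 (mod 8)`).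
* `offCut_goodSS_false` — the assembled statement E1⁺ of the skeleton (same binders).

References: [cite: SilvermanAEC2009, VII.5.1, III.1, App. A Prop. 1.1] [cite: SilvermanATAEC1994, IV.9.4 and Table 4.1]
-/

set_option autoImplicit false

noncomputable section

open scoped Classical

open IsDedekindDomain IsDedekindDomain.HeightOneSpectrum NumberField WeierstrassCurve
  Literature.NumberTheory.EllipticCurves Literature.NumberTheory.DiophantineGeometry

namespace Summit.BirchSwinnertonDyer.BirchSwinnertonDyer.Theorems.GenusExact.GoodSSHabitat

/-! ## S3 — pure arithmetic -/

/-- An odd natural number squares to `1` modulo `8`. [folklore] -/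
theorem natCast_sq_eq_one_of_odd (m : ℕ) (hm : m % 2 = 1) : ((m : ZMod 8)) ^ 2 = 1 := by
  rw [← ZMod.natCast_mod m 8]
  have h : m % 8 = 1 ∨ m % 8 = 3 ∨ m % 8 = 5 ∨ m % 8 = 7 := by omega
  rcases h with h | h | h | h <;> rw [h] <;> decide

/-- Powers of `3` are `1` or `3` modulo `8`. [folklore] -/
theorem three_pow_mod_eight (k : ℕ) : (3 : ZMod 8) ^ k = 1 ∨ (3 : ZMod 8) ^ k = 3 := by
  induction k with
  | zero => exact Or.inl (pow_zero _)
  | succ k ih =>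
    rcases ih with h | h <;> rw [pow_succ, h] <;> decide

/-- **S3 (registered stub `stub_no_pos_discr` of LINE 33, verbatim signature): a positive integer `≡ 5 (mod 8)`
has a prime `p ≥ 5` of odd valuation.** If every prime `p ≥ 5` had even valuation then, `Δ` being odd,
`Δ = 3^a · m²` with `m` odd, so `Δ ≡ 3^a ≡ 1, 3 (mod 8)`. [cite: HardyWright2008, Thm. 2 (unique factorisation)] -/
theorem no_pos_int_five_mod_eight_of_even_val (Δ : ℤ) (hpos : 0 < Δ) (h8 : Δ % 8 = 5)
    (hev : ∀ p : ℕ, p.Prime → 5 ≤ p → Even (padicValInt p Δ)) : False := by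
  obtain ⟨n, rfl⟩ : ∃ n : ℕ, Δ = n := ⟨Δ.toNat, (Int.toNat_of_nonneg hpos.le).symm⟩
  have hn0 : n ≠ 0 := by omega
  have hn8 : n % 8 = 5 := by omega
  -- the product formula, read in `ZMod 8`
  have hprod : (n : ZMod 8) = n.factorization.prod fun p k => (p : ZMod 8) ^ k := by
    conv_lhs => rw [← Nat.prod_factorization_pow_eq_self hn0]
    rw [Nat.cast_finsuppProd]
    simp only [Nat.cast_pow]
  -- every factor is `1` or `3`
  have hmem : ∀ p ∈ n.factorization.support,
      (p : ZMod 8) ^ n.factorization p = 1 ∨ (p : ZMod 8) ^ n.factorization p = 3 := by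
    intro p hp
    rw [Nat.support_factorization] at hp
    have hpr : p.Prime := Nat.prime_of_mem_primeFactors hp
    have hpd : p ∣ n := Nat.dvd_of_mem_primeFactors hp
    have hp2 : p ≠ 2 := by rintro rfl; omega
    by_cases hp3 : p = 3
    · subst hp3
      exact_mod_cast three_pow_mod_eight (n.factorization 3)
    · have h5 : 5 ≤ p := by
        by_contra h
        have h2 := hpr.two_le
        interval_cases p <;> simp_all (config := { decide := true })
      obtain ⟨j, hj⟩ := (hev p hpr h5)
      rw [padicValInt.of_nat, ← Nat.factorization_def n hpr] at hj
      have hodd : p % 2 = 1 := Nat.odd_iff.mp (hpr.odd_of_ne_two hp2)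
      left
      rw [hj, ← two_mul, pow_mul, natCast_sq_eq_one_of_odd p hodd, one_pow]
  have h13 : (n : ZMod 8) = 1 ∨ (n : ZMod 8) = 3 := by
    rw [hprod, Finsupp.prod]
    refine Finset.prod_induction _ (fun x : ZMod 8 => x = 1 ∨ x = 3) ?_ (Or.inl rfl) hmem
    rintro a b (rfl | rfl) (rfl | rfl) <;> decide
  have h5 : (n : ZMod 8) = 5 := by
    rw [← ZMod.natCast_mod n 8, hn8]; rfl
  rw [h5] at h13
  rcases h13 with h | h <;> exact absurd h (by decide)

/-! ## S1 — good supersingular reduction at `2` forces `Δ_min ≡ 5 (mod 8)` -/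

/-- The `𝔽₂`-identity behind the rational `2`-torsion point of an ordinary curve in characteristic `2`: for
`ā₁ = 1` the point `(ā₃, ȳ)`, `ȳ = ā₃³ + ā₂ā₃² + ā₄ā₃ + ā₆`, lies on the curve and equals its own negative.
[folklore] -/
theorem zmod_two_torsion_identity : ∀ a₂ a₃ a₄ a₆ : ZMod 2,
    ((a₃ ^ 3 + a₂ * a₃ ^ 2 + a₄ * a₃ + a₆) ^ 2 + 1 * a₃ * (a₃ ^ 3 + a₂ * a₃ ^ 2 + a₄ * a₃ + a₆)
        + a₃ * (a₃ ^ 3 + a₂ * a₃ ^ 2 + a₄ * a₃ + a₆) = a₃ ^ 3 + a₂ * a₃ ^ 2 + a₄ * a₃ + a₆) ∧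
      (a₃ ^ 3 + a₂ * a₃ ^ 2 + a₄ * a₃ + a₆ = -(a₃ ^ 3 + a₂ * a₃ ^ 2 + a₄ * a₃ + a₆) - 1 * a₃ - a₃) := by
  decide

/-- **If `Δ_min` is odd and `a₁` is odd, the reduction modulo `2` has an even number of points** (the affine point
`(ā₃, ȳ)` above is nonsingular since `Δ̄ ≠ 0`, and `ȳ = negY ā₃ ȳ` makes it a point of order `2`; Lagrange).
[cite: SilvermanAEC2009, III.2.3 and III.1.4] -/
theorem two_dvd_reductionPointCount_of_odd_a₁ (W : WeierstrassCurve ℚ) [W.IsGloballyMinimal]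
    (hΔ : ¬ (2 : ℤ) ∣ minimalDiscriminantInt W) (h1 : ¬ (2 : ℤ) ∣ (integralModelInt W).a₁) :
    2 ∣ reductionPointCount W 2 := by
  set M : WeierstrassCurve ℤ := integralModelInt W with hM
  set M₂ : WeierstrassCurve (ZMod 2) := M.map (Int.castRingHom (ZMod 2)) with hM₂
  have hcast : ∀ z : ℤ, ¬ (2 : ℤ) ∣ z → (z : ZMod 2) = 1 := by
    intro z hz
    have hne : (z : ZMod 2) ≠ 0 := by
      intro h
      exact hz (by exact_mod_cast (ZMod.intCast_zmod_eq_zero_iff_dvd z 2).mp h)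
    have key : ∀ x : ZMod 2, x ≠ 0 → x = 1 := by decide
    exact key _ hne
  have h1' : M₂.a₁ = 1 := by
    rw [hM₂, map_a₁, eq_intCast]
    exact hcast _ h1
  have hΔ2 : M₂.Δ ≠ 0 := by
    rw [hM₂, map_Δ, eq_intCast, hcast _ (by simpa [hM, minimalDiscriminantInt] using hΔ)]
    exact one_ne_zero
  set x₀ : ZMod 2 := M₂.a₃ with hx₀
  set y₀ : ZMod 2 := M₂.a₃ ^ 3 + M₂.a₂ * M₂.a₃ ^ 2 + M₂.a₄ * M₂.a₃ + M₂.a₆ with hy₀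
  have heq : M₂.toAffine.Equation x₀ y₀ := by
    rw [WeierstrassCurve.Affine.equation_iff]
    change y₀ ^ 2 + M₂.a₁ * x₀ * y₀ + M₂.a₃ * y₀ = x₀ ^ 3 + M₂.a₂ * x₀ ^ 2 + M₂.a₄ * x₀ + M₂.a₆
    rw [h1', hy₀, hx₀]
    have := (zmod_two_torsion_identity M₂.a₂ M₂.a₃ M₂.a₄ M₂.a₆).1
    linear_combination this
  have hns : M₂.toAffine.Nonsingular x₀ y₀ :=
    (WeierstrassCurve.Affine.equation_iff_nonsingular_of_Δ_ne_zero hΔ2).mp heq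
  have hy : y₀ = M₂.toAffine.negY x₀ y₀ := by
    rw [WeierstrassCurve.Affine.negY]
    change y₀ = -y₀ - M₂.a₁ * x₀ - M₂.a₃
    rw [h1', hy₀, hx₀]
    exact (zmod_two_torsion_identity M₂.a₂ M₂.a₃ M₂.a₄ M₂.a₆).2
  set T : M₂.toAffine.Point := .some _ _ hns with hT
  have hT2 : addOrderOf T = 2 :=
    addOrderOf_eq_prime (by rw [two_nsmul]; exact WeierstrassCurve.Affine.Point.add_self_of_Y_eq hy)
      (WeierstrassCurve.Affine.Point.some_ne_zero hns)
  have hdvd := addOrderOf_dvd_natCard T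
  rw [hT2] at hdvd
  simpa [reductionPointCount, hM₂, hM] using hdvd

/-- **S1 (registered stub `stub_discr_emod_eight_of_goodSS` of LINE 33, verbatim signature): good supersingular
reduction at `2` on a globally minimal model forces `Δ ≡ 5 (mod 8)`** (over an integer `t` with `W.Δ = t`).
`2 ∤ Δ_min` (good reduction); `2 ∣ a₂ = 3 − #Ẽ(𝔽₂)` forces `#Ẽ(𝔽₂)` odd, so by
`two_dvd_reductionPointCount_of_odd_a₁` the coefficient `a₁` is even; then `Δ` odd forces `a₃` odd, and
`Δ = −b₂²b₈ − 8b₄³ − 27b₆² + 9b₂b₄b₆` with `b₂ = 4c`, `b₄ = 2d`, `b₆² = 8w + 1` gives `Δ = 8E − 27`.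
[cite: SilvermanAEC2009, VII.5.1, III.1 (b-invariants), App. A Prop. 1.1] -/
theorem discr_emod_eight_of_goodSS (W : WeierstrassCurve ℚ) [W.IsElliptic] [W.IsGloballyMinimal]
    (hss : Literature.NumberTheory.EllipticCurves.Rank1Residual.GoodSS W 2) :
    ∃ t : ℤ, W.Δ = (t : ℚ) ∧ t % 8 = 5 := by
  refine ⟨minimalDiscriminantInt W, (cast_minimalDiscriminantInt W).symm, ?_⟩
  obtain ⟨hgood, hap⟩ := hss
  have hodd : ¬ (2 : ℤ) ∣ minimalDiscriminantInt W :=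
    W.not_dvd_minimalDiscriminantInt_of_hasGoodReductionAtPrime' 2 hgood
  set M : WeierstrassCurve ℤ := integralModelInt W with hM
  have hΔM : minimalDiscriminantInt W = M.Δ := rfl
  -- Step A: `a₁` is even
  have ha1 : (2 : ℤ) ∣ M.a₁ := by
    by_contra h1
    obtain ⟨k, hk⟩ := two_dvd_reductionPointCount_of_odd_a₁ W hodd h1
    obtain ⟨j, hj⟩ := hap
    rw [frobeniusTrace, hk] at hj
    push_cast at hj
    omega
  obtain ⟨α, hα⟩ := ha1
  -- Step B: `a₃` is odd
  have hb2 : M.b₂ = 4 * (α ^ 2 + M.a₂) := by rw [WeierstrassCurve.b₂, hα]; ring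
  have ha3 : ¬ (2 : ℤ) ∣ M.a₃ := by
    rintro ⟨γ', hγ'⟩
    apply hodd
    rw [hΔM]
    have hb4 : M.b₄ = 2 * (M.a₄ + 2 * α * γ') := by rw [WeierstrassCurve.b₄, hα, hγ']; ring
    have hb6 : M.b₆ = 4 * (γ' ^ 2 + M.a₆) := by rw [WeierstrassCurve.b₆, hγ']; ring
    refine ⟨-8 * (α ^ 2 + M.a₂) ^ 2 * M.b₈ - 32 * (M.a₄ + 2 * α * γ') ^ 3 - 216 * (γ' ^ 2 + M.a₆) ^ 2
      + 144 * (α ^ 2 + M.a₂) * (M.a₄ + 2 * α * γ') * (γ' ^ 2 + M.a₆), ?_⟩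
    rw [WeierstrassCurve.Δ, hb2, hb4, hb6]; ring
  have hodd3 : Odd M.a₃ := Int.not_even_iff_odd.mp fun h ↦ ha3 (even_iff_two_dvd.mp h)
  obtain ⟨γ, hγ⟩ := hodd3
  -- Step C: `Δ = 8 E − 27`
  have hb4 : M.b₄ = 2 * (M.a₄ + α * M.a₃) := by rw [WeierstrassCurve.b₄, hα]; ring
  have hw : M.b₆ ^ 2 = 8 * (2 * (γ ^ 2 + γ + M.a₆) ^ 2 + (γ ^ 2 + γ + M.a₆)) + 1 := by
    rw [WeierstrassCurve.b₆, hγ]; ring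
  have hΔ : M.Δ = 8 * (-2 * (α ^ 2 + M.a₂) ^ 2 * M.b₈ - 8 * (M.a₄ + α * M.a₃) ^ 3
      - 27 * (2 * (γ ^ 2 + γ + M.a₆) ^ 2 + (γ ^ 2 + γ + M.a₆))
      + 9 * (α ^ 2 + M.a₂) * (M.a₄ + α * M.a₃) * M.b₆) - 27 := by
    rw [WeierstrassCurve.Δ, hb2, hb4]
    linear_combination (-27 : ℤ) * hw
  rw [hΔM, hΔ]
  omega

/-! ## S2 — on the odd-Tamagawa off-cut cell every prime `p ≥ 5` has even `v_p(Δ_min)` -/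

open Literature.NumberTheory.DiophantineGeometry.UniformABCConjecture (natCast_mem_asIdeal_iff)

/-- The residue ring `𝓞 ℚ ⧸ v` has characteristic the prime under `v`. [folklore] -/
theorem ringChar_quot_eq_natGenerator (v : HeightOneSpectrum (𝓞 ℚ)) :
    ringChar (𝓞 ℚ ⧸ v.asIdeal) = Rat.HeightOneSpectrum.natGenerator v := by
  haveI : Nontrivial (𝓞 ℚ ⧸ v.asIdeal) := Ideal.Quotient.nontrivial_iff.mpr v.isPrime.ne_top
  apply CharP.ringChar_of_prime_eq_zero (Rat.HeightOneSpectrum.prime_natGenerator v)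
  rw [← map_natCast (Ideal.Quotient.mk v.asIdeal), Ideal.Quotient.eq_zero_iff_mem]
  exact (natCast_mem_asIdeal_iff v _).mpr dvd_rfl

/-- **S2 (registered stub `stub_even_padicValInt_discr` of LINE 33, verbatim signature): on the odd-`C` off-cut
cell every prime `p ≥ 5` has EVEN `v_p(Δ_min)`** (over an integer `t = W.Δ`). If `p ∣ Δ_min` then `p` is a bad
prime (`ordMinimalDiscriminant_eq_zero_iff`), it divides the conductor (`hasGoodReductionAtPrime_of_not_dvd_conductorNorm'`),
so by `hoff` it is not multiplicative, hence additive (Mathlib's trichotomy on the local minimal model); its local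
Tamagawa number divides the odd `∏ c_ℓ`, so Tate's algorithm excludes the types III, III* (`c = 2`) and `Iₙ*`,
`n ≥ 1` (`c ∈ {2, 4}`), and Ogg–Saito in residue characteristic `≥ 5` gives `v_p(Δ_min) = m_v + 1 ∈ {2, 4, 6, 8, 10}`
on the remaining types II, IV, I₀*, IV*, II*. [cite: SilvermanATAEC1994, IV.9.4 (Steps 3–10) and Table 4.1]
[cite: SilvermanAEC2009, VII.5.1] -/
theorem even_padicValInt_discr_of_odd_tamagawaProduct (W : WeierstrassCurve ℚ) [W.IsElliptic]
    [W.IsGloballyMinimal] [NeZero (W.conductorNorm ℤ)]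
    (hT : Odd W.tamagawaProduct)
    (hoff : ¬ ∃ v : HeightOneSpectrum (𝓞 ℚ), ((2 : ℕ) : 𝓞 ℚ) ∉ v.asIdeal ∧ ((W.conductorNorm ℤ : ℕ) : 𝓞 ℚ) ∈ v.asIdeal ∧
      W.HasMultiplicativeReductionAt v)
    (t : ℤ) (ht : W.Δ = (t : ℚ)) (p : ℕ) (hp : p.Prime) (h5 : 5 ≤ p) : Even (padicValInt p t) := by
  have htΔ : t = minimalDiscriminantInt W := by
    have h := (cast_minimalDiscriminantInt W).trans ht
    exact_mod_cast h.symm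
  subst htΔ
  by_cases hpd : (p : ℤ) ∣ minimalDiscriminantInt W
  swap
  · rw [padicValInt.eq_zero_of_not_dvd hpd]; exact ⟨0, rfl⟩
  haveI : Fact p.Prime := ⟨hp⟩
  -- the place `v` of `ℚ` over `p`
  set v : HeightOneSpectrum (𝓞 ℚ) := Rat.HeightOneSpectrum.primesEquiv.symm ⟨p, hp⟩ with hvdef
  have hv : (Rat.HeightOneSpectrum.primesEquiv v : ℕ) = p := by simp [hvdef]
  have hgen : Rat.HeightOneSpectrum.natGenerator v = p := hv
  haveI : PerfectField (IsLocalRing.ResidueField (v.adicCompletionIntegers ℚ)) := PerfectField.ofFinite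
  -- `ord_v Δ_min = v_p(Δ_min) ≠ 0`: bad reduction at `v`
  have hord : W.ordMinimalDiscriminant v = padicValInt p (minimalDiscriminantInt W) :=
    Castella2018.TamagawaQuadratic.ordMinimalDiscriminant_eq_padicValInt W v hv
  have hne : padicValInt p (minimalDiscriminantInt W) ≠ 0 := by
    intro h0
    rw [padicValInt, padicValNat.eq_zero_iff] at h0
    rcases h0 with h0 | h0 | h0
    · exact hp.one_lt.ne' h0
    · exact minimalDiscriminantInt_ne_zero W (Int.natAbs_eq_zero.mp h0)
    · exact h0 (Int.natAbs_dvd_natAbs.mpr hpd)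
  have hbad : ¬ W.HasGoodReductionAt v := fun hg ↦
    hne (hord ▸ (W.ordMinimalDiscriminant_eq_zero_iff_holds v).mpr hg)
  -- not multiplicative at `v` (the off-cut hypothesis): `p ∣ N`, `p ≠ 2`
  have hbadp : ¬ W.HasGoodReductionAtPrime p := fun hg ↦
    W.not_dvd_minimalDiscriminantInt_of_hasGoodReductionAtPrime' p hg hpd
  have hN : p ∣ W.conductorNorm ℤ :=
    not_not.mp fun h ↦ hbadp (W.hasGoodReductionAtPrime_of_not_dvd_conductorNorm' h)
  have hnmult : ¬ W.HasMultiplicativeReductionAt v := by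
    intro hm
    refine hoff ⟨v, ?_, ?_, hm⟩
    · rw [natCast_mem_asIdeal_iff, hgen]
      intro h2
      have := Nat.le_of_dvd two_pos h2
      omega
    · rw [natCast_mem_asIdeal_iff, hgen]
      exact hN
  -- hence additive at `v`
  have hadd : W.HasAdditiveReductionAt v := by
    rcases WeierstrassCurve.hasGoodReduction_or_hasMultiplicativeReduction_or_hasAdditiveReduction
        (R := v.adicCompletionIntegers ℚ) (W := W.localMinimalModel v) with h | h | h
    · exact (hbad h).elim
    · exact (hnmult h).elim
    · exact h
  -- the local Tamagawa number at `v` is odd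
  have hcv : Odd ((W.baseChange (v.adicCompletion ℚ)).localTamagawaNumber (v.adicCompletionIntegers ℚ)) :=
    Odd.of_dvd_nat hT (finprod_mem_dvd v W.mulSupport_localTamagawaNumber_finite_holds)
  -- Ogg–Saito in residue characteristic `≥ 5`
  have h2 : ringChar (𝓞 ℚ ⧸ v.asIdeal) ≠ 2 := by rw [ringChar_quot_eq_natGenerator v, hgen]; omega
  have h3 : ringChar (𝓞 ℚ ⧸ v.asIdeal) ≠ 3 := by rw [ringChar_quot_eq_natGenerator v, hgen]; omega
  have hOgg : W.ordMinimalDiscriminant v = W.numComponentsAt v + 1 :=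
    W.ordMinimalDiscriminant_eq_numComponentsAt_add_one_holds v hadd h2 h3
  rw [← hord, hOgg]
  unfold numComponentsAt
  -- Tate's algorithm: the Kodaira type at `v`
  rcases hk : W.kodairaSymbolAt v with (_ | m) | _ | _ | _ | (_ | n) | _ | _ | _
  · -- `I₀`: good reduction — excluded
    exact (hbad ((WeierstrassCurve.isGood_kodairaSymbolAt_iff_holds v W).mp hk)).elim
  · -- `Iₘ₊₁`: multiplicative — excluded
    exact (hnmult ((WeierstrassCurve.kodairaSymbolAt_eq_I_iff_holds v W m.succ_ne_zero).mp hk).1).elim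
  · -- `II`: `m = 1`, `v(Δ) = 2`
    exact ⟨1, rfl⟩
  · -- `III`: `c = 2` — excluded by parity
    rw [localTamagawaNumber_eq_two_of_kodairaSymbolAt_eq_III_holds v W hk] at hcv
    exact absurd hcv (by decide)
  · -- `IV`: `m = 3`, `v(Δ) = 4`
    exact ⟨2, rfl⟩
  · -- `I₀*`: `m = 5`, `v(Δ) = 6`
    exact ⟨3, rfl⟩
  · -- `Iₙ₊₁*`: `c ∈ {2, 4}` — excluded by parity
    rcases localTamagawaNumber_of_kodairaSymbolAt_eq_Istar_succ_holds v W n hk with h | h <;>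
      rw [h] at hcv <;> exact absurd hcv (by decide)
  · -- `IV*`: `m = 7`, `v(Δ) = 8`
    exact ⟨4, rfl⟩
  · -- `III*`: `c = 2` — excluded by parity
    rw [localTamagawaNumber_eq_two_of_kodairaSymbolAt_eq_IIIstar_holds v W hk] at hcv
    exact absurd hcv (by decide)
  · -- `II*`: `m = 9`, `v(Δ) = 10`
    exact ⟨5, rfl⟩

/-! ## E1⁺ — the assembled emptiness statement of LINE 33 §6 -/

/-- **E1⁺ (`offCut_goodSS_false` of LINE 33 §6, verbatim binders; now sorry-free): the good-supersingular off-cut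
sub-habitat of the K₄⁺ cell is EMPTY** — on a globally minimal elliptic `W/ℚ` with odd Tamagawa product, `Δ > 0`
and no odd multiplicative prime, good supersingular reduction at `2` is impossible (S1: `Δ_min ≡ 5 (mod 8)`;
S2: every `p ≥ 5` has even `v_p(Δ_min)`; S3: contradiction). [cite: SilvermanATAEC1994, IV.9 Table 4.1]
[cite: SilvermanAEC2009, VII.5.1] -/
theorem offCut_goodSS_false (W : WeierstrassCurve ℚ) [W.IsElliptic] [W.IsGloballyMinimal] [NeZero (W.conductorNorm ℤ)]
    (hT : Odd W.tamagawaProduct) (hpos : 0 < W.Δ)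
    (hoff : ¬ ∃ v : HeightOneSpectrum (𝓞 ℚ), ((2 : ℕ) : 𝓞 ℚ) ∉ v.asIdeal ∧ ((W.conductorNorm ℤ : ℕ) : 𝓞 ℚ) ∈ v.asIdeal ∧
      W.HasMultiplicativeReductionAt v)
    (hss : Literature.NumberTheory.EllipticCurves.Rank1Residual.GoodSS W 2) : False := by
  obtain ⟨t, ht, h8⟩ := discr_emod_eight_of_goodSS W hss
  have htpos : (0 : ℚ) < (t : ℚ) := ht ▸ hpos
  exact no_pos_int_five_mod_eight_of_even_val t (by exact_mod_cast htpos) h8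
    (fun p hp h5 ↦ even_padicValInt_discr_of_odd_tamagawaProduct W hT hoff t ht p hp h5)

end Summit.BirchSwinnertonDyer.BirchSwinnertonDyer.Theorems.GenusExact.GoodSSHabitat
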